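import Literature.ModelTheory.ExponentialFields.LastRootConjecture
import Mathlib.Algebra.MvPolynomial.Eval
import HarnessLib

/-!
# Dictionary: ring terms ↔ integer polynomials ↔ exponential-polynomial codes

Family `periods` (periods.S27), topic `Literature/ModelTheory/ExponentialFields`: glue for the
assembly of the conditional half of Macintyre–Wilkie's theorem
(`Literature.ModelTheory.ExponentialFields.macintyreWilkie_existential_of_schanuelProperty`).  Three presentations of
an exponential polynomial `p(x̄, e^{x̄})` over `ℤ` occur in the decomposition: parameter-free
terms `p` of the language of ordered rings in the variables `(x̄, ȳ)` (the output of the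
existential reduction, `ExistentialReduction.lean` / its `OEF` version), integer polynomials
`P ∈ ℤ[x̄, ȳ]` (Mathlib's `MvPolynomial`, in which the Schanuel algebra takes place), and
monomial codes `List (ℤ × List ℕ)` (`ExpPolyCode`, `LastRootConjecture.lean`, in which the Newton
scheme is written and Gödel numbers are computed).  This file provides the two conversions with
their semantics (all proved):

* `Language.orderedRing.termToMvPoly : Term α → MvPolynomial α ℤ` and
  `realize_eq_aeval_termToMvPoly` — in ANY commutative ring (carrying the notation-class
  structure `Language.orderedRing.instStructure`), `t(v) = aeval v (termToMvPoly t)`;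
* `ExpPolyCode.ofMvPoly N : MvPolynomial (Fin N ⊕ Fin N) ℤ → ExpPolyCode` and
  `ExpPolyCode.eval_ofMvPoly` — in `ℝ`, `eval N (ofMvPoly N P) x̄ = aeval (x̄, e^{x̄}) P`.

## References

* A. Macintyre, A. J. Wilkie, *On the decidability of the real exponential field* (1996), §§4–5.
* G. O. Jones, T. Servi, *On the decidability of the real field with a generic power function*,
  J. Symb. Log. 76 (2011), §3 (Lemma 3.3: existential sentences as `∃x̄ g(x̄) = 0`,
  `g ∈ M_n(ℤ[α])`).
-/

noncomputable section

open FirstOrder FirstOrder.Language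
open scoped BigOperators

namespace Literature.ModelTheory.ExponentialFields

/-! ### Ring terms as integer polynomials -/

namespace Language.orderedRing

/-- The integer polynomial of a term of the language of ordered rings (variables `α`, no
parameters beyond them): `x ↦ X x`, `0, 1, +, *, -`. [folklore] -/
def termToMvPoly {α : Type*} : Language.orderedRing.Term α → MvPolynomial α ℤ
  | var a => MvPolynomial.X a
  | func ringFunc.add ts => (fun i => termToMvPoly (ts i)) 0 + (fun i => termToMvPoly (ts i)) 1
  | func ringFunc.mul ts => (fun i => termToMvPoly (ts i)) 0 * (fun i => termToMvPoly (ts i)) 1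
  | func ringFunc.neg ts => -(fun i => termToMvPoly (ts i)) 0
  | func ringFunc.zero _ => 0
  | func ringFunc.one _ => 1

/-- **Terms realize to the evaluation of their polynomial**, in every commutative ring with the
notation-class structure for `(+, *, -, 0, 1, ≤)`. [folklore] -/
theorem realize_eq_aeval_termToMvPoly {R : Type*} [CommRing R] [LE R] {α : Type*} (v : α → R) :
    ∀ t : Language.orderedRing.Term α, t.realize v = MvPolynomial.aeval v (termToMvPoly t)
  | var a => by simp [termToMvPoly]
  | func ringFunc.add ts => by
    rw [Term.realize_func, funMap_add]
    simp only [termToMvPoly, map_add, realize_eq_aeval_termToMvPoly v (ts 0),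
      realize_eq_aeval_termToMvPoly v (ts 1)]
  | func ringFunc.mul ts => by
    rw [Term.realize_func, funMap_mul]
    simp only [termToMvPoly, map_mul, realize_eq_aeval_termToMvPoly v (ts 0),
      realize_eq_aeval_termToMvPoly v (ts 1)]
  | func ringFunc.neg ts => by
    rw [Term.realize_func, funMap_neg]
    simp only [termToMvPoly, map_neg, realize_eq_aeval_termToMvPoly v (ts 0)]
  | func ringFunc.zero ts => by
    rw [Term.realize_func, funMap_zero]
    simp [termToMvPoly]
  | func ringFunc.one ts => by
    rw [Term.realize_func, funMap_one]
    simp [termToMvPoly]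

end Language.orderedRing

/-! ### Integer polynomials in `(x̄, ȳ)` as exponential-polynomial codes -/

namespace ExpPolyCode

variable (N : ℕ)

/-- the exponent list of a monomial of `ℤ[x₁, …, x_N, y₁, …, y_N]`: positions `0 … N-1` for the
`xᵢ`, positions `N … 2N-1` for the `yᵢ` (the convention of `monomialEval`) [folklore] -/
def expList (m : (Fin N ⊕ Fin N) →₀ ℕ) : List ℕ :=
  List.ofFn fun i : Fin (N + N) => m (finSumFinEquiv.symm i)

/-- Reading the exponents off `expList`: the `xᵢ`. [folklore] -/
theorem getD_expList_inl (m : (Fin N ⊕ Fin N) →₀ ℕ) (i : Fin N) :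
    (expList N m).getD (i : ℕ) 0 = m (Sum.inl i) := by
  have hi : (i : ℕ) < N + N := by omega
  rw [expList, List.getD_eq_getElem?_getD, List.getElem?_ofFn]
  simp only [hi, ↓reduceDIte, Option.getD_some]
  congr 1
  have : (⟨(i : ℕ), hi⟩ : Fin (N + N)) = Fin.castAdd N i := rfl
  rw [this, finSumFinEquiv_symm_apply_castAdd]

/-- Reading the exponents off `expList`: the `yᵢ`. [folklore] -/
theorem getD_expList_inr (m : (Fin N ⊕ Fin N) →₀ ℕ) (i : Fin N) :
    (expList N m).getD (N + (i : ℕ)) 0 = m (Sum.inr i) := by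
  have hi : N + (i : ℕ) < N + N := by omega
  rw [expList, List.getD_eq_getElem?_getD, List.getElem?_ofFn]
  simp only [hi, ↓reduceDIte, Option.getD_some]
  congr 1
  have : (⟨N + (i : ℕ), hi⟩ : Fin (N + N)) = Fin.natAdd N i := rfl
  rw [this, finSumFinEquiv_symm_apply_natAdd]

/-- **The code of an integer polynomial `P ∈ ℤ[x̄, ȳ]`**: one entry `(coefficient, exponents)` per
monomial of the support. [folklore] -/
def ofMvPoly (P : MvPolynomial (Fin N ⊕ Fin N) ℤ) : ExpPolyCode :=
  P.support.toList.map fun m => (P.coeff m, expList N m)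

/-- The value of the monomial `(c, expList m)` at `x̄`: `c · ∏ᵥ (x̄, e^{x̄})ᵥ^{m v}`. [folklore] -/
theorem monomialEval_expList (c : ℤ) (m : (Fin N ⊕ Fin N) →₀ ℕ) (x : Fin N → ℝ) :
    monomialEval N (c, expList N m) x =
      (c : ℝ) * m.prod (fun v e => (Sum.elim x (Real.exp ∘ x) v) ^ e) := by
  rw [monomialEval, Finsupp.prod_fintype _ _ (fun v => by simp), Fintype.prod_sum_type]
  simp only [getD_expList_inl, getD_expList_inr, Sum.elim_inl, Sum.elim_inr, Function.comp_apply,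
    Finset.prod_mul_distrib]

/-- `eval` of a mapped list of codes is the sum of the values. [folklore] -/
theorem eval_map {ι : Type*} (l : List ι) (f : ι → ℤ × List ℕ) (x : Fin N → ℝ) :
    eval N (l.map f) x = (l.map fun i => monomialEval N (f i) x).sum := by
  induction l with
  | nil => rfl
  | cons a l ih => simp [ih]

/-- **The code of `P` evaluates to `P(x̄, e^{x̄})`** in `ℝ`. [folklore] -/
theorem eval_ofMvPoly (P : MvPolynomial (Fin N ⊕ Fin N) ℤ) (x : Fin N → ℝ) :
    eval N (ofMvPoly N P) x = MvPolynomial.aeval (Sum.elim x (Real.exp ∘ x)) P := by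
  rw [ofMvPoly, eval_map, Finset.sum_map_toList]
  conv_rhs => rw [P.as_sum, map_sum]
  refine Finset.sum_congr rfl fun m _ => ?_
  rw [monomialEval_expList, MvPolynomial.aeval_monomial, Algebra.algebraMap_eq_smul_one, zsmul_eq_mul, mul_one]

end ExpPolyCode

end Literature.ModelTheory.ExponentialFields

end
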